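import Summits.AtomisticToContinuum.FouriersLaw.Theses.BondHeatUncertainty
import Summits.AtomisticToContinuum.FouriersLaw.Theorems.ExtensiveSnapshotIrreversibility.Negative.LoadBearingHypotheses
import Summits.AtomisticToContinuum.FouriersLaw.Theorems.ExtensiveSnapshotIrreversibility.Negative.DegenerateInstances
import Summits.AtomisticToContinuum.FouriersLaw.Theorems.BondHeatUncertaintyExtensiveSnapshotIrreversibilityKernelFacts
import Summits.AtomisticToContinuum.FouriersLaw.Theorems.BondHeatUncertaintyExtensiveSnapshotIrreversibilityCorrectorIntegrability
import Summits.AtomisticToContinuum.FouriersLaw.Theorems.BondHeatUncertaintyExtensiveSnapshotIrreversibilityCorrectorCocycle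
import Summits.AtomisticToContinuum.FouriersLaw.Theorems.BondHeatUncertaintyExtensiveSnapshotIrreversibilityGibbsContactCalculus
import Summits.AtomisticToContinuum.FouriersLaw.Theorems.BondHeatUncertaintyExtensiveSnapshotIrreversibilityClausiusBudget
import Summits.AtomisticToContinuum.FouriersLaw.Theorems.BondHeatUncertaintyExtensiveSnapshotIrreversibilityMcLennanIdentification
import Summits.AtomisticToContinuum.FouriersLaw.Theorems.BondHeatUncertaintyExtensiveSnapshotIrreversibilitySnapshotKLUpperReduction
import Summits.AtomisticToContinuum.FouriersLaw.Theorems.BondHeatUncertaintyExtensiveSnapshotIrreversibilityResponseDensity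
import Summits.AtomisticToContinuum.FouriersLaw.Theorems.BondHeatUncertaintyExtensiveSnapshotIrreversibilityLateOddResponseOfFisher
import Summits.AtomisticToContinuum.FouriersLaw.Theorems.BondHeatUncertaintyExtensiveSnapshotIrreversibilityCorrectorHeatSplit
import Summits.AtomisticToContinuum.FouriersLaw.Theorems.BondHeatUncertaintyExtensiveSnapshotIrreversibilityOddLogDensityOfRegularity
import Summits.AtomisticToContinuum.FouriersLaw.Theorems.BondHeatUncertaintyExtensiveSnapshotIrreversibilityOddLogDensityOfOddRegularity
import Summits.AtomisticToContinuum.FouriersLaw.Theorems.BondHeatUncertaintyExtensiveSnapshotIrreversibilityOddCorrectorOfKuboCorrector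

/-!
# Line `clausius-budget-sound-window` — lead's skeleton (v10) for the crux
`BondHeatUncertainty.ExtensiveSnapshotIrreversibility` (item stmt-AtomisticToContinuum-9121)

Lead prover-line-stmt-AtomisticToContinuum-9121-0, 2026-08-16. Reshaped from the planner's checked skeleton
`Cruxes/ExtensiveSnapshotIrreversibility/Lines/clausius-budget-sound-window.lean` (same line, same composition idea:
window split of the McLennan corrector at `τ ≤ cN`, Clausius budget for the window, late odd response for the rest,
fixed-`N` KL identification; `N = 0, 1` by the landed degenerate instances). What changed and why:

* NO LOCAL DEFINITIONS: every stub is stated in tree vocabulary only (`pinnedChain`, `transitionKernel`, `gibbsMeasure`,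
  `hamiltonian`, `IsSteadyState`, Mathlib `MemLp` / `klDiv` / `Measure.bind`), the line's objects being `let`-bound
  inside each signature (`g` source, `Pg s` its equilibrium evolution, `k τ` window response, `w` McLennan corrector,
  `Pw τ` evolved corrector, `μT` Gibbs at the mean temperature) — so that each stub can be landed verbatim under
  `Theorems/` (which cannot import `Cruxes/`) with `--supports stmt-AtomisticToContinuum-9121`.
* THE COMMON KERNEL DEBT IS A STUB, PAID IN-TREE UNDER THE GUARD (`stub_equilibriumKernelFacts`, S0): under weak-NESS
  uniqueness the Gibbs measure `μ_T` IS the Krylov–Bogoliubov invariant probability measure of the constructed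
  equilibrium kernels (`pinnedChainSemigroup_exists_isInvariant` + `IsInvariant.isSteadyState` + the guard +
  `pinnedChain_isSteadyState_gibbsMeasure`; H2 is PROVED: `CuneoEckmannHairerReyBellet2018_H2_holds`), hence (i) `μ_T`
  is invariant for `transitionKernel N T T t`, and (ii) CEHR (2.5) exponential convergence to `μ_T(f)` in the
  `e^{ϑH}`-weighted norm holds (`pinnedChainSemigroup_exp_convergence`, minorisation Hörmander-free via
  `pinnedChain_localSmall` / `pinnedChain_minorization_of_localSmall`). Every other stub takes (i), (ii) as HYPOTHESES
  (discharged by S0 in the composition), never re-derives them.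
* S2 of the planner is split at the skeleton level into S2a `stub_correctorIntegrability` (absolute convergence of the
  McLennan integral, `L²(μ_T)` membership of `w`, `k τ`, `P_τ w`, and the POINTWISE window identity `w = k τ + P_τ w`)
  and S2b `stub_correctorCocycle` (Minkowski + flip-invariance of `μ_T` ⇒ `√D(w) ≤ 2‖k τ‖ + √D(P_τ w)`).
* S3 of the planner is split into S3a `stub_gibbsContactCalculus` (STATIC, provable now: the `L²(μ_T)` Dirichlet form of
  the equilibrium generator on `C_c^∞` is the Ornstein–Uhlenbeck form of the two contact momenta — the Liouville part is
  antisymmetric — and the Gaussian integration by parts `⟨p_i² − T, f⟩ = T⟨p_i, ∂_{p_i} f⟩`) and S3b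
  `stub_clausiusBudget` (the DYNAMIC lever `‖k τ‖² ≤ γτ/(4T²)`, taking S3a, (i), (ii) and `k τ ∈ L²` as hypotheses).
* All `N`-uniform / family statements carry the uniqueness guard of the crux (costless: the composition has it).

Registered stubs, v3 (2026-08-16T08:10Z): LANDED — S0 `stub_equilibriumKernelFacts` (p77081), S2a
`stub_correctorIntegrability` (p81088), S2b `stub_correctorCocycle` (p82521), S3a `stub_gibbsContactCalculus` (p82446),
S3b `stub_clausiusBudget` (p89857, with support chain p85547/p86210/p87268/p88946: THE N-UNIFORM CLAUSIUS BUDGET IS A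
THEOREM), S1a `stub_mcLennanIdentification` (p91177), S1b `stub_responseDensity` (p95551, = item 9144 now PROVED); OPEN — (former S1b entry:) S1b `stub_responseDensity` (= sibling item stmt-9144 BY
NAME), S1c `stub_snapshotKLUpper` ⟸ (reduction p91778) S1d `stub_oddLogDensity` (the unprinted fixed-`N` debt), S4 `stub_lateOddResponse` (HARDEST, the lead's; the
crux's `N`-uniform content). `ExtensiveSnapshotIrreversibility_of` concludes the crux BY NAME; its arithmetic core
`concl_of_parts` is abstract real arithmetic (sorry-free in closure).

Registered stubs, v6 (c1 continuation lead prover-line-stmt-AtomisticToContinuum-9121-c1-0, 2026-08-16T11Z): the two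
open stubs of v5 are RESHAPED, both derived decls keeping their v5 signatures byte-for-byte —
S1d `stub_oddLogDensity` := S1g `stub_oddLogDensity_of_regularity` (fixed N, dominated convergence + landed S0/S2a/S1a,
provable now) applied to S1r `stub_logDensityRegularity` (THE isolated fixed-`N` debt: two-sided Gibbs-type bound,
Lipschitz-in-`δ` polynomial bound and pointwise `δ`-derivative of the NESS log-density `log(dμ_δ/dμ_T)`);
S4 `stub_lateOddResponse` := landed p91965 (`lateOddResponse_of_extensiveFisher`) ∘ S4s `stub_correctorHeatSplit`
(fixed N: `w = (Q_L − Q_R)/2T²`, `Q_i ∈ L²`, provable now) ∘ S4v `stub_heatCommittorVariance` (THE `N`-uniform residual,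
the lead's: `∫Q_L², ∫Q_R² dμ_T ≤ C·N` for the one-bath heat committors `Q_i = ∫₀^∞ P_s γ(p_i² − T) ds` — parity-free,
NESS-free, = extensive Fisher information = card two-bath-fisher-covariance's C⁺). Open: S1r, S1g, S4s, S4v (4 `sorry`).
v7 (2026-08-16T13Z): S4s LANDED p98471, S1g LANDED p103202 (wave 1) — open: S1r (fixed-N debt), S4v (N-uniform residual); 2 `sorry`.

Registered stubs, v8 (c2 continuation lead prover-line-stmt-AtomisticToContinuum-9121-c2-0, 2026-08-16T18Z): both open stubs
RESHAPED to their minimal honest form, derived decls keeping their signatures byte-for-byte —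
S4 `stub_lateOddResponse` := landed p91965 ∘ S4f `stub_extensiveFisherInformation` (THE `N`-uniform residual, the lead's:
`∫ w² dμ_T ≤ C·N`, extensive Fisher information of the two-temperature family at `δ = 0`; S4s/S4v of v6–v7 leave the critical
path, S4s stays landed p98471, S4v ⟺ S4f by `‖Q_L‖² = ¼Var_T H + T⁴‖w‖²` and the sub-goal `gibbs_hamiltonian_variance_le`);
S1d `stub_oddLogDensity` := S1g' `stub_oddLogDensity_of_oddRegularity` (fixed N, dominated convergence, provable now) applied to
S1r' `stub_oddLogDensityRegularity` (the fixed-`N` debt WEAKENED: upper Gibbs-type bound + pointwise continuity of `φ_δ`, and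
two-sided `O(δ)` control + pointwise derivative of the ODD part `φ_δ − φ_δ∘Θ` only). Open: S1r', S1g', S4f (3 `sorry`, S1g' in wave 1).
v8.1 (2026-08-16T19Z): wave 1 LANDED S1g' p120594 (+Aux1 p119814), sub-goals ness_tendsto_gibbsMeasure p119406, gibbs_hamiltonian_variance_le
p119686, (R1) ness_eq_gibbs_withDensity_exp p119469, ness_gibbs_integral_sub_le p119946, ness_density_tendsto_of_equicontinuous p120513 —
open: S1r' (fixed-N debt: F1 local δ-uniform hypoelliptic regularity + M2/M2' pointwise δ-derivative of the log-density), S4f (N-uniform); 2 `sorry`.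

Registered stubs, v9 (c3 continuation lead prover-line-stmt-AtomisticToContinuum-9121-c3-0, 2026-08-16T19Z): S4f RESHAPED to its
necessary-and-sufficient form S4o `stub_oddCorrectorBound` (`∫ (w − w∘Θ)² dμ_T ≤ C·N`: given the fixed-`N` expansion S1a–S1d this IS
`2K_N ≤ C·N`, the crux's exact `N`-uniform content; S4 follows at `τ = 0`; S4f ⟹ S4o trivially and S4f's reduction p91965 stays landed);
S1r' unchanged. Open: S1r' (fixed `N`), S4o (`N`-uniform, CRUX-SIZED: an estimate of Fourier-law type for the deterministic anharmonic
bulk — handed back to the planners as `promote-stub`, see `Cruxes/…/NOTES.md`); 2 `sorry`. With S4o at `τ = 0` the window split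
(S2b) and the Clausius budget (S3b) are no longer load-bearing in `concl_of_parts` (they bound a term that S4o already controls); they
stay in the composition as landed theorems.

Registered stubs, v10 (c4 continuation lead prover-line-stmt-AtomisticToContinuum-9121-c4-0, 2026-08-16T20Z): S4o RESHAPED into the
currency of the sibling route `OddSectorIrreversibility` — S4o `stub_oddCorrectorBound` := landed reduction
`oddCorrectorBound_of_kuboCorrectorOddCubic` (c4, this cycle; uses S0/S1a/S1b/S2a + the sibling's PROVED item 9146
`OddDensityIsCorrector`) applied to the NEW registered stub S4k `stub_kuboCorrectorOddCubicBound`: a CUBIC `N`-uniform bound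
`∫ (u − u∘Θ)² dμ_T ≤ C·N³` on the odd part of the Kubo corrector `u = ∫₀^∞ P_t J_tot dt` of the TOTAL current (equilibrium
open kernels, normalised Gibbs measure; the predicate on `u` is verbatim that of `OddDensityIsCorrector`). S4k is EQUIVALENT to S4o
(continuity equation: `T²(w − w∘Θ) = −(u − u∘Θ)/(N−1)` a.e.) hence still the crux's exact `N`-uniform content, but it is now
literally implied — with a factor `N` and the even sector to spare — by the sibling route's live rank-2 crux E1 `ConeScaleCorrector`
(stmt-AtomisticToContinuum-14069; landed bridge `kuboCorrectorOddCubic_of_coneScale`, hypothesis = E1's definiens verbatim): ONE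
`N`-uniform open problem serves both routes, (K) being the weaker consumer (cubic/odd: order-tight at the harmonic corner where E1's
`N²` fails). Open: S1r' (fixed `N`), S4k (`N`-uniform, ⟸ E1); 2 `sorry`.

Disproof.lean (cdisprove cycles 1–2, NO KILL) honoured exactly as in the planner's skeleton: family hypothesis used (S1,
`N = 0,1` glue), `0 < T` everywhere (`T⁻²` constants, Disproof §4 `StrengtheningUniformT`), eventual-in-`δ` only
(`false_withAllDelta`), `C·N` never `o(N)` (harmonic corner `K_N = N/6 − 2/9` carried by S4).
-/

noncomputable section

namespace Summit.AtomisticToContinuum.FouriersLaw.Cruxes.ExtensiveSnapshotIrreversibility.ClausiusBudgetSoundWindow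

open MeasureTheory Filter Topology InformationTheory
open scoped ENNReal NNReal
open Literature.MathematicalPhysics.KineticTheory.HeatConduction
open Summit.AtomisticToContinuum.FouriersLaw.Theses.BondHeatUncertainty
open Summit.AtomisticToContinuum.FouriersLaw.Theorems.ExtensiveSnapshotIrreversibility.Negative

/-! ## Stubs (`sorry` only here)

Common `let`-dictionary inside the signatures (for `P = pinnedChain ω₂ lam β γ`, `N ≥ 2`, `T > 0`):
`μT := P.gibbsMeasure N T`; `g y := γ/(2T²)·(p_0² − p_{N−1}²)` (the SOURCE); `Pg s z := ∫ g d(P.transitionKernel N T T s z)`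
(`s : ℝ`, read through `Real.toNNReal`); `k τ z := ∫₀^τ Pg s z ds` (WINDOW RESPONSE); `w z := ∫_{s>0} Pg s z ds` (McLENNAN
CORRECTOR, improper Bochner integral); `Pw τ z := ∫ w d(P.transitionKernel N T T τ z)` (evolved corrector); flip `Θ z = (z.1, −z.2)`.
Hypothesis blocks: (INV) `∀ t, μT.bind (P.transitionKernel N T T t) = μT`; (MIX) CEHR (2.5) at equilibrium:
`∀ ϑ ∈ (0, 1/T) ∃ C c > 0 ∀ z t f`, `f` continuous with `|f| ≤ e^{ϑH}` ⇒ `|P_t f(z) − μT(f)| ≤ C e^{ϑH(z)} e^{−ct}`. -/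

/-- **S0 `stub_equilibriumKernelFacts`** (fixed `N ≥ 1`, size M, provable from the tree). Under weak-NESS uniqueness,
for `T > 0`: (INV) the Gibbs measure at `T` is invariant for the constructed equilibrium kernels `transitionKernel N T T t`,
and (MIX) the equilibrium semigroup converges exponentially to `μ_T(f)` in the `e^{ϑH}`-weighted norm for every
`0 < ϑ < 1/T`. Proof route: `pinnedChainSemigroup_exists_isInvariant CuneoEckmannHairerReyBellet2018_H2_holds` gives a
Krylov–Bogoliubov invariant probability measure `μ⋆` of `pinnedChainSemigroup` (kernels = `transitionKernel`, simp lemma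
`pinnedChainSemigroup_kernel`); `LangevinChainSemigroup.IsInvariant.isSteadyState` makes it a weak steady state at
`(T, T)`; the guard and `pinnedChain_isSteadyState_gibbsMeasure` give `μ⋆ = gibbsMeasure N T`; (MIX) is
`pinnedChainSemigroup_exp_convergence` with `h36 := pinnedChain_minorization_of_localSmall … pinnedChain_localSmall`
(`max T T = T`). -/
theorem stub_equilibriumKernelFacts :
    ∀ ω₂ lam β γ : ℝ, 0 < ω₂ → 0 < lam → 0 < β → 0 < γ →
      (∀ (N : ℕ) (T_L T_R : ℝ), 0 < T_L → 0 < T_R → ∀ μ ν : Measure (PhaseSpace N),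
        (pinnedChain ω₂ lam β γ).IsSteadyState N T_L T_R μ →
        (pinnedChain ω₂ lam β γ).IsSteadyState N T_L T_R ν → μ = ν) →
      ∀ T : ℝ, 0 < T → ∀ N : ℕ, 0 < N →
        let P := pinnedChain ω₂ lam β γ
        let μT := P.gibbsMeasure N T
        (∀ t : ℝ≥0, μT.bind (P.transitionKernel N T T t) = μT) ∧
        (∀ ϑ : ℝ, 0 < ϑ → ϑ < 1 / T → ∃ C c : ℝ, 0 < C ∧ 0 < c ∧
          ∀ (z : PhaseSpace N) (t : ℝ≥0) (f : PhaseSpace N → ℝ), Continuous f →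
            (∀ y, |f y| ≤ Real.exp (ϑ * P.hamiltonian N y)) →
            |(∫ y, f y ∂(P.transitionKernel N T T t z)) - ∫ y, f y ∂μT| ≤
              C * Real.exp (ϑ * P.hamiltonian N z) * Real.exp (-c * t)) :=
  -- LANDED (p77081): Theorems/BondHeatUncertaintyExtensiveSnapshotIrreversibilityKernelFacts.lean
  Summit.AtomisticToContinuum.FouriersLaw.Theorems.ExtensiveSnapshotIrreversibility.ClausiusBudget.stub_equilibriumKernelFacts

/-- **S1a `stub_mcLennanIdentification`** (fixed `N ≥ 2`, size L, PROVABLE NOW modulo assembling — reshaped 2026-08-16 from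
the blocked S1). Under the guard, along a steady-state family, for `T > 0`, `N ≥ 2`, given (INV), (MIX) and `w ∈ L²(μ_T)`:
EVERY `L²` linear-response density `h` of `δ ↦ μ_{N,T+δ/2,T−δ/2}` at `δ = 0` (the interface of the sibling item
`OddSectorIrreversibility.ResponseDensity`, verbatim) has the same reversal asymmetry as the McLennan corrector:
`∫ (h − h∘Θ)² d(μ N T T) = ∫ (w − w∘Θ)² dμ_T` (indeed `h = w∘Θ` a.e.; McLennan / MaesNetocny2010). Route: `μ N T T = μ_T`
(guard + `pinnedChain_isSteadyState_gibbsMeasure`); the weak adjoint equation `∫ (L_T F) h dμ_T = −∫ F g dμ_T` for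
`F ∈ C_c^∞` is PROVED in tree (`…Theorems.OddSectorIrreversibility.integral_generator_mul_responseDensity_gibbs`, p79055);
`w` is a weak solution of `L_T k = −g` and kernel detailed balance `P_s† = ΘP_sΘ` on `L²(μ_T)` follows from the essential
m-dissipativity of `(L, C_c^∞)` in `L²(μ_T)` (density of `Range(1−L)C_c^∞`:
`OddSectorIrreversibility.exists_testFunction_resolvent_approx`, landed, used by S3b) plus the static identity
`∫ G (L F) dμ_T = ∫ (ΘLΘ G) F dμ_T`; weak `L²` solutions of `L_T†k = 0` are a.e. constant ((MIX) + the same core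
property), whence `h − w∘Θ` is a.e. constant and the odd parts agree. -/
theorem stub_mcLennanIdentification :
    ∀ ω₂ lam β γ : ℝ, 0 < ω₂ → 0 < lam → 0 < β → 0 < γ →
      (∀ (N : ℕ) (T_L T_R : ℝ), 0 < T_L → 0 < T_R → ∀ μ ν : Measure (PhaseSpace N),
        (pinnedChain ω₂ lam β γ).IsSteadyState N T_L T_R μ →
        (pinnedChain ω₂ lam β γ).IsSteadyState N T_L T_R ν → μ = ν) →
      ∀ μ : (N : ℕ) → ℝ → ℝ → Measure (PhaseSpace N),
        (∀ (N : ℕ) (T_L T_R : ℝ), 0 < T_L → 0 < T_R →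
          (pinnedChain ω₂ lam β γ).IsSteadyState N T_L T_R (μ N T_L T_R)) →
        ∀ T : ℝ, 0 < T → ∀ (N : ℕ) (hN : 2 ≤ N),
          let P := pinnedChain ω₂ lam β γ
          let μT := P.gibbsMeasure N T
          (∀ t : ℝ≥0, μT.bind (P.transitionKernel N T T t) = μT) →
          (∀ ϑ : ℝ, 0 < ϑ → ϑ < 1 / T → ∃ C c : ℝ, 0 < C ∧ 0 < c ∧
            ∀ (z : PhaseSpace N) (t : ℝ≥0) (f : PhaseSpace N → ℝ), Continuous f →
              (∀ y, |f y| ≤ Real.exp (ϑ * P.hamiltonian N y)) →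
              |(∫ y, f y ∂(P.transitionKernel N T T t z)) - ∫ y, f y ∂μT| ≤
                C * Real.exp (ϑ * P.hamiltonian N z) * Real.exp (-c * t)) →
          let g : PhaseSpace N → ℝ := fun y =>
            γ / (2 * T ^ 2) * (y.2 ⟨0, by omega⟩ ^ 2 - y.2 ⟨N - 1, by omega⟩ ^ 2)
          let Pg : ℝ → PhaseSpace N → ℝ := fun s z => ∫ y, g y ∂(P.transitionKernel N T T s.toNNReal z)
          let w : PhaseSpace N → ℝ := fun z => ∫ s in Set.Ioi (0 : ℝ), Pg s z
          MemLp w 2 μT →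
          ∀ h : PhaseSpace N → ℝ,
            (MemLp h 2 (μ N T T) ∧
              (∀ F : PhaseSpace N → ℝ, ContDiff ℝ ((⊤ : ℕ∞) : WithTop ℕ∞) F → HasCompactSupport F →
                Tendsto (fun δ : ℝ => ((∫ x, F x ∂(μ N (T + δ / 2) (T - δ / 2))) - ∫ x, F x ∂(μ N T T)) / δ)
                  (𝓝[≠] (0 : ℝ)) (𝓝 (∫ x, F x * h x ∂(μ N T T)))) ∧
              (∀ i : Fin N, Tendsto (fun δ : ℝ =>
                  ((∫ x, (pinnedChain ω₂ lam β γ).bondCurrent N i x ∂(μ N (T + δ / 2) (T - δ / 2))) -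
                    ∫ x, (pinnedChain ω₂ lam β γ).bondCurrent N i x ∂(μ N T T)) / δ)
                  (𝓝[≠] (0 : ℝ)) (𝓝 (∫ x, (pinnedChain ω₂ lam β γ).bondCurrent N i x * h x ∂(μ N T T))))) →
            ∫ x, (h x - h (x.1, -x.2)) ^ 2 ∂(μ N T T) = ∫ z, (w z - w (z.1, -z.2)) ^ 2 ∂μT :=
  -- LANDED (p91177): Theorems/BondHeatUncertaintyExtensiveSnapshotIrreversibilityMcLennanIdentification.lean
  Summit.AtomisticToContinuum.FouriersLaw.Theorems.ExtensiveSnapshotIrreversibility.ClausiusBudget.stub_mcLennanIdentification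

/-- **S1b `stub_responseDensity`** (fixed `N`, size L) — VERBATIM the statement of the sibling route item
`OddSectorIrreversibility.ResponseDensity` (stmt-AtomisticToContinuum-9144, OPEN, has its own prover seat; stated as text, not by
name, so that this skeleton does not import a route file under edit): under the
guard, along every steady-state family, for `T > 0` and every `N`, a linear-response density `h ∈ L²(μ N T T)` of
`δ ↦ μ_{N,T+δ/2,T−δ/2}` at `δ = 0` exists (weak derivative tested on `C_c^∞` observables and on the bond currents). When that
item closes, the gate appends `ResponseDensity_holds` to its route file and this stub is discharged by a three-line file
importing it; no worker of this line duplicates that seat. -/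
theorem stub_responseDensity :
    ∀ ω₂ lam β γ : ℝ, 0 < ω₂ → 0 < lam → 0 < β → 0 < γ →
      (∀ (N : ℕ) (T_L T_R : ℝ), 0 < T_L → 0 < T_R → ∀ μ ν : Measure (PhaseSpace N),
        (pinnedChain ω₂ lam β γ).IsSteadyState N T_L T_R μ →
        (pinnedChain ω₂ lam β γ).IsSteadyState N T_L T_R ν → μ = ν) →
      ∀ μ : (N : ℕ) → ℝ → ℝ → Measure (PhaseSpace N),
        (∀ (N : ℕ) (T_L T_R : ℝ), 0 < T_L → 0 < T_R →
          (pinnedChain ω₂ lam β γ).IsSteadyState N T_L T_R (μ N T_L T_R)) →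
        ∀ T : ℝ, 0 < T → ∀ N : ℕ,
          ∃ h : PhaseSpace N → ℝ,
            (MemLp h 2 (μ N T T) ∧
              (∀ F : PhaseSpace N → ℝ, ContDiff ℝ ((⊤ : ℕ∞) : WithTop ℕ∞) F → HasCompactSupport F →
                Tendsto (fun δ : ℝ => ((∫ x, F x ∂(μ N (T + δ / 2) (T - δ / 2))) - ∫ x, F x ∂(μ N T T)) / δ)
                  (𝓝[≠] (0 : ℝ)) (𝓝 (∫ x, F x * h x ∂(μ N T T)))) ∧
              (∀ i : Fin N, Tendsto (fun δ : ℝ =>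
                  ((∫ x, (pinnedChain ω₂ lam β γ).bondCurrent N i x ∂(μ N (T + δ / 2) (T - δ / 2))) -
                    ∫ x, (pinnedChain ω₂ lam β γ).bondCurrent N i x ∂(μ N T T)) / δ)
                  (𝓝[≠] (0 : ℝ)) (𝓝 (∫ x, (pinnedChain ω₂ lam β γ).bondCurrent N i x * h x ∂(μ N T T))))) :=
  -- DISCHARGED (p95551) by the sibling item stmt-9144, proved 2026-08-16 (…OddSectorIrreversibility.Corrector.responseDensity_holds)
  Summit.AtomisticToContinuum.FouriersLaw.Theorems.ExtensiveSnapshotIrreversibility.ClausiusBudget.stub_responseDensity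

/-- **S1r' `stub_oddLogDensityRegularity`** (fixed `N ≥ 2`; reshaped by the c2 lead 2026-08-16 from S1r — THE unprinted
fixed-`N` analytic debt, WEAKENED: two-sided control is asked only of the ODD part of the NESS log-density). Under the guard, along
every steady-state family, for `T > 0`, `N ≥ 2`: for `δ ≠ 0` small the steady state is the Gibbs state at `T` reweighted by `e^{φ_δ}`
(clause (R1): positive density — LANDED ingredients p115843 + p105925), with (R2u) an UPPER Gibbs-type bound `φ_δ ≤ η(1 + H)` uniform
in small `δ` (`η < 1/(4T)`; pointwise hypoelliptic `L¹ → L^∞` estimate with polynomial constants + the landed uniform exponential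
moments `ness_uniform_exp_moment`), (R0) pointwise continuity `φ_δ(x) → 0` as `δ → 0` (local uniform convergence of the NESS
densities to the Gibbs density: equicontinuity + the weak continuity `ness_tendsto_gibbsMeasure`), (R3o) a two-sided
Lipschitz-in-`δ` bound with polynomial weight for the ODD part only, `|φ_δ − φ_δ∘Θ| ≤ C|δ|(1 + H)^k`, and (R4o) pointwise
differentiability of the odd part at `δ = 0`: `(φ_δ − φ_δ∘Θ)(x)/δ → d₀(x)` for a measurable `d₀`. No lower bound on the density
relative to Gibbs is asked any more (the v7 clause `|φ_δ| ≤ η(1+H)` and the two-sided `|φ_δ| ≤ C|δ|(1+H)^k` are gone): what stays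
two-sided is `d_δ = log ρ_δ − log ρ_δ∘Θ`, the log-odds of a state against its momentum reversal, `≈ δ·`(directional energy
content)`/T²`. S1d follows from it by dominated convergence (`stub_oddLogDensity_of_oddRegularity`). Not in print
(MaesNetocny2010 Thm 3.1 is conditional on smooth density dependence; EckmannPilletReyBellet1999a is one-sided in a Gibbs-weighted `L²`). -/
theorem stub_oddLogDensityRegularity :
    ∀ ω₂ lam β γ : ℝ, 0 < ω₂ → 0 < lam → 0 < β → 0 < γ →
      (∀ (N : ℕ) (T_L T_R : ℝ), 0 < T_L → 0 < T_R → ∀ μ ν : Measure (PhaseSpace N),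
        (pinnedChain ω₂ lam β γ).IsSteadyState N T_L T_R μ →
        (pinnedChain ω₂ lam β γ).IsSteadyState N T_L T_R ν → μ = ν) →
      ∀ μ : (N : ℕ) → ℝ → ℝ → Measure (PhaseSpace N),
        (∀ (N : ℕ) (T_L T_R : ℝ), 0 < T_L → 0 < T_R →
          (pinnedChain ω₂ lam β γ).IsSteadyState N T_L T_R (μ N T_L T_R)) →
        ∀ T : ℝ, 0 < T → ∀ N : ℕ, 2 ≤ N →
          ∃ δ₀ η C : ℝ, ∃ k : ℕ, 0 < δ₀ ∧ 0 < η ∧ η < 1 / (4 * T) ∧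
          ∃ φ : ℝ → PhaseSpace N → ℝ, ∃ d₀ : PhaseSpace N → ℝ,
            (∀ δ : ℝ, Measurable (φ δ)) ∧ Measurable d₀ ∧
            (∀ δ : ℝ, δ ≠ 0 → |δ| < δ₀ →
              μ N (T + δ / 2) (T - δ / 2) =
                ((pinnedChain ω₂ lam β γ).gibbsMeasure N T).withDensity
                  (fun x => ENNReal.ofReal (Real.exp (φ δ x)))) ∧
            (∀ δ : ℝ, |δ| < δ₀ → ∀ x : PhaseSpace N,
              φ δ x ≤ η * (1 + (pinnedChain ω₂ lam β γ).hamiltonian N x)) ∧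
            (∀ x : PhaseSpace N, Tendsto (fun δ : ℝ => φ δ x) (𝓝[≠] (0 : ℝ)) (𝓝 0)) ∧
            (∀ δ : ℝ, |δ| < δ₀ → ∀ x : PhaseSpace N,
              |φ δ x - φ δ (x.1, -x.2)| ≤
                C * |δ| * (1 + (pinnedChain ω₂ lam β γ).hamiltonian N x) ^ k) ∧
            (∀ x : PhaseSpace N,
              Tendsto (fun δ : ℝ => (φ δ x - φ δ (x.1, -x.2)) / δ) (𝓝[≠] (0 : ℝ)) (𝓝 (d₀ x))) := by
  sorry

/-- **S1g' `stub_oddLogDensity_of_oddRegularity`** (fixed `N ≥ 2`, size L, PROVABLE NOW: dominated convergence, same tools as the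
landed S1g p103202 minus the McLennan identification). The odd-regularity statement S1r' implies S1d verbatim: on `0 < |δ| < δ₀` put
`ρ_δ := e^{φ_δ} · e^{-H/T}/Z` (positive, measurable; `gibbsMeasure = volume.withDensity (gibbsDensity/Z)`), so
`log ρ_δ − log ρ_δ∘Θ = φ_δ − φ_δ∘Θ` (`H` is even in the momenta, `hamiltonian_neg_momentum`); by (R3o)+(R4o) and (R2u)+(R0),
`δ⁻²∫(φ_δ − φ_δ∘Θ)² e^{φ_δ} dμ_T → ∫ d₀² dμ_T` (integrand `→ d₀²·e⁰` pointwise; dominated by `C²(1+H)^{2k} e^{η(1+H)} ∈ L¹(μ_T)`,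
`pinnedChain_integrable_exp_mul_hamiltonian_gibbsMeasure`). IDENTIFICATION of `d₀` with the odd part of the GIVEN response density
`h`: for `F ∈ C_c^∞`, testing the response hypothesis on `F` and `F∘Θ` gives `δ⁻¹∫ F (e^{φ_δ} − e^{φ_δ∘Θ}) dμ_T → ∫ F (h − h∘Θ) dμ_T`
(`μ N T T = μ_T` by the guard + `pinnedChain_isSteadyState_gibbsMeasure`; flip-invariance of `μ_T`, `gibbsMeasure_map_flip`), while
pointwise `δ⁻¹(e^{φ_δ} − e^{φ_δ∘Θ}) = e^{φ_δ∘Θ}(e^{φ_δ−φ_δ∘Θ} − 1)/δ → d₀` with the domination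
`|e^a − e^b| ≤ e^{max(a,b)}|a − b| ≤ e^{η(1+H)} C(1+H)^k` ((R2u) at `x` and `Θx`, (R3o)) — no lower bound needed; hence
`∫ F d₀ dμ_T = ∫ F (h − h∘Θ) dμ_T` for all `F ∈ C_c^∞`, `d₀ = h − h∘Θ` `μ_T`-a.e. (`OddLogDensity.ae_eq_of_tendsto_testFunction`,
landed), so `∫ d₀² dμ_T = ∫ (h − h∘Θ)² dμ_{N,T,T} < D` and the bound `≤ Dδ²` holds eventually; integrability of
`(log ρ_δ − log ρ_δ∘Θ)²` under `μ_δ` is the same domination. -/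
theorem stub_oddLogDensity_of_oddRegularity :
    (∀ ω₂ lam β γ : ℝ, 0 < ω₂ → 0 < lam → 0 < β → 0 < γ →
      (∀ (N : ℕ) (T_L T_R : ℝ), 0 < T_L → 0 < T_R → ∀ μ ν : Measure (PhaseSpace N),
        (pinnedChain ω₂ lam β γ).IsSteadyState N T_L T_R μ →
        (pinnedChain ω₂ lam β γ).IsSteadyState N T_L T_R ν → μ = ν) →
      ∀ μ : (N : ℕ) → ℝ → ℝ → Measure (PhaseSpace N),
        (∀ (N : ℕ) (T_L T_R : ℝ), 0 < T_L → 0 < T_R →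
          (pinnedChain ω₂ lam β γ).IsSteadyState N T_L T_R (μ N T_L T_R)) →
        ∀ T : ℝ, 0 < T → ∀ N : ℕ, 2 ≤ N →
          ∃ δ₀ η C : ℝ, ∃ k : ℕ, 0 < δ₀ ∧ 0 < η ∧ η < 1 / (4 * T) ∧
          ∃ φ : ℝ → PhaseSpace N → ℝ, ∃ d₀ : PhaseSpace N → ℝ,
            (∀ δ : ℝ, Measurable (φ δ)) ∧ Measurable d₀ ∧
            (∀ δ : ℝ, δ ≠ 0 → |δ| < δ₀ →
              μ N (T + δ / 2) (T - δ / 2) =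
                ((pinnedChain ω₂ lam β γ).gibbsMeasure N T).withDensity
                  (fun x => ENNReal.ofReal (Real.exp (φ δ x)))) ∧
            (∀ δ : ℝ, |δ| < δ₀ → ∀ x : PhaseSpace N,
              φ δ x ≤ η * (1 + (pinnedChain ω₂ lam β γ).hamiltonian N x)) ∧
            (∀ x : PhaseSpace N, Tendsto (fun δ : ℝ => φ δ x) (𝓝[≠] (0 : ℝ)) (𝓝 0)) ∧
            (∀ δ : ℝ, |δ| < δ₀ → ∀ x : PhaseSpace N,
              |φ δ x - φ δ (x.1, -x.2)| ≤
                C * |δ| * (1 + (pinnedChain ω₂ lam β γ).hamiltonian N x) ^ k) ∧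
            (∀ x : PhaseSpace N,
              Tendsto (fun δ : ℝ => (φ δ x - φ δ (x.1, -x.2)) / δ) (𝓝[≠] (0 : ℝ)) (𝓝 (d₀ x)))) →
    ∀ ω₂ lam β γ : ℝ, 0 < ω₂ → 0 < lam → 0 < β → 0 < γ →
      (∀ (N : ℕ) (T_L T_R : ℝ), 0 < T_L → 0 < T_R → ∀ μ ν : Measure (PhaseSpace N),
        (pinnedChain ω₂ lam β γ).IsSteadyState N T_L T_R μ →
        (pinnedChain ω₂ lam β γ).IsSteadyState N T_L T_R ν → μ = ν) →
      ∀ μ : (N : ℕ) → ℝ → ℝ → Measure (PhaseSpace N),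
        (∀ (N : ℕ) (T_L T_R : ℝ), 0 < T_L → 0 < T_R →
          (pinnedChain ω₂ lam β γ).IsSteadyState N T_L T_R (μ N T_L T_R)) →
        ∀ T : ℝ, 0 < T → ∀ N : ℕ, 2 ≤ N → ∀ h : PhaseSpace N → ℝ,
          (MemLp h 2 (μ N T T) ∧
            (∀ F : PhaseSpace N → ℝ, ContDiff ℝ ((⊤ : ℕ∞) : WithTop ℕ∞) F → HasCompactSupport F →
              Tendsto (fun δ : ℝ => ((∫ x, F x ∂(μ N (T + δ / 2) (T - δ / 2))) - ∫ x, F x ∂(μ N T T)) / δ)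
                (𝓝[≠] (0 : ℝ)) (𝓝 (∫ x, F x * h x ∂(μ N T T)))) ∧
            (∀ i : Fin N, Tendsto (fun δ : ℝ =>
                ((∫ x, (pinnedChain ω₂ lam β γ).bondCurrent N i x ∂(μ N (T + δ / 2) (T - δ / 2))) -
                  ∫ x, (pinnedChain ω₂ lam β γ).bondCurrent N i x ∂(μ N T T)) / δ)
                (𝓝[≠] (0 : ℝ)) (𝓝 (∫ x, (pinnedChain ω₂ lam β γ).bondCurrent N i x * h x ∂(μ N T T))))) →
          ∀ D : ℝ, ∫ x, (h x - h (x.1, -x.2)) ^ 2 ∂(μ N T T) < D →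
            ∀ᶠ δ in 𝓝[≠] (0 : ℝ), ∃ ρ : PhaseSpace N → ℝ, Measurable ρ ∧ (∀ x, 0 < ρ x) ∧
              μ N (T + δ / 2) (T - δ / 2) =
                (volume : Measure (PhaseSpace N)).withDensity (fun x => ENNReal.ofReal (ρ x)) ∧
              Integrable (fun x => (Real.log (ρ x) - Real.log (ρ (x.1, -x.2))) ^ 2)
                (μ N (T + δ / 2) (T - δ / 2)) ∧
              ∫ x, (Real.log (ρ x) - Real.log (ρ (x.1, -x.2))) ^ 2 ∂(μ N (T + δ / 2) (T - δ / 2))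
                ≤ D * δ ^ 2 :=
  -- LANDED (p120594: Theorems/BondHeatUncertaintyExtensiveSnapshotIrreversibilityOddLogDensityOfOddRegularity.lean; Aux1 p119814)
  Summit.AtomisticToContinuum.FouriersLaw.Theorems.ExtensiveSnapshotIrreversibility.ClausiusBudget.stub_oddLogDensity_of_oddRegularity

/-- **S1d `stub_oddLogDensity`** (fixed `N ≥ 2`) — DERIVED: S1r' + S1g' (v8; v7 derived it from the stronger S1r via the landed S1g
p103202). Under the guard, along every steady-state family, for `T > 0`, `N ≥ 2`, every `L²` response density `h` and every
`D > ∫ (h − h∘Θ)² dμ_{N,T,T}`: eventually in `δ ≠ 0` the steady state `μ_{N,T+δ/2,T−δ/2}` has an everywhere POSITIVE measurable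
Lebesgue density `ρ_δ` whose odd log-part satisfies `∫ (log ρ_δ − log ρ_δ∘Θ)² dμ_δ ≤ D δ²`. -/
theorem stub_oddLogDensity :
    ∀ ω₂ lam β γ : ℝ, 0 < ω₂ → 0 < lam → 0 < β → 0 < γ →
      (∀ (N : ℕ) (T_L T_R : ℝ), 0 < T_L → 0 < T_R → ∀ μ ν : Measure (PhaseSpace N),
        (pinnedChain ω₂ lam β γ).IsSteadyState N T_L T_R μ →
        (pinnedChain ω₂ lam β γ).IsSteadyState N T_L T_R ν → μ = ν) →
      ∀ μ : (N : ℕ) → ℝ → ℝ → Measure (PhaseSpace N),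
        (∀ (N : ℕ) (T_L T_R : ℝ), 0 < T_L → 0 < T_R →
          (pinnedChain ω₂ lam β γ).IsSteadyState N T_L T_R (μ N T_L T_R)) →
        ∀ T : ℝ, 0 < T → ∀ N : ℕ, 2 ≤ N → ∀ h : PhaseSpace N → ℝ,
          (MemLp h 2 (μ N T T) ∧
            (∀ F : PhaseSpace N → ℝ, ContDiff ℝ ((⊤ : ℕ∞) : WithTop ℕ∞) F → HasCompactSupport F →
              Tendsto (fun δ : ℝ => ((∫ x, F x ∂(μ N (T + δ / 2) (T - δ / 2))) - ∫ x, F x ∂(μ N T T)) / δ)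
                (𝓝[≠] (0 : ℝ)) (𝓝 (∫ x, F x * h x ∂(μ N T T)))) ∧
            (∀ i : Fin N, Tendsto (fun δ : ℝ =>
                ((∫ x, (pinnedChain ω₂ lam β γ).bondCurrent N i x ∂(μ N (T + δ / 2) (T - δ / 2))) -
                  ∫ x, (pinnedChain ω₂ lam β γ).bondCurrent N i x ∂(μ N T T)) / δ)
                (𝓝[≠] (0 : ℝ)) (𝓝 (∫ x, (pinnedChain ω₂ lam β γ).bondCurrent N i x * h x ∂(μ N T T))))) →
          ∀ D : ℝ, ∫ x, (h x - h (x.1, -x.2)) ^ 2 ∂(μ N T T) < D →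
            ∀ᶠ δ in 𝓝[≠] (0 : ℝ), ∃ ρ : PhaseSpace N → ℝ, Measurable ρ ∧ (∀ x, 0 < ρ x) ∧
              μ N (T + δ / 2) (T - δ / 2) =
                (volume : Measure (PhaseSpace N)).withDensity (fun x => ENNReal.ofReal (ρ x)) ∧
              Integrable (fun x => (Real.log (ρ x) - Real.log (ρ (x.1, -x.2))) ^ 2)
                (μ N (T + δ / 2) (T - δ / 2)) ∧
              ∫ x, (Real.log (ρ x) - Real.log (ρ (x.1, -x.2))) ^ 2 ∂(μ N (T + δ / 2) (T - δ / 2))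
                ≤ D * δ ^ 2 :=
  stub_oddLogDensity_of_oddRegularity stub_oddLogDensityRegularity


/-- **S1c `stub_snapshotKLUpper`** (fixed `N ≥ 2`, size L; THE unprinted fixed-`N` debt shared by every line of this crux,
Disproof §7/§9). Under the guard, along every steady-state family, for `T > 0`, `N ≥ 2` and EVERY `L²` response density
`h` (interface verbatim as in `ResponseDensity`): for every `K > ½∫(h − h∘Θ)² d(μ N T T)`, eventually in `δ ≠ 0`,
`KL(μ_δ ‖ Θ_*μ_δ) ≤ K δ²` — the UPPER half of the second-order expansion `KL = ½δ²D(h) + o(δ²)`, which carries FINITENESS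
of `KL` for small `δ` (positive NESS density `ρ_δ = e^{φ_δ}ρ_T`, `φ_δ − φ_δ∘Θ ∈ L¹(μ_δ)`: exact criterion and the
tilted sandwich `½∫d²e^{−d/2}dμ_δ ≤ KL ≤ ∫d² dμ_δ`, `d = φ_δ − φ_δ∘Θ`, are LANDED in Negative/TiltedCriterion, TiltedFloor;
what is missing is `d = δ(h − h∘Θ) + o(δ)` in `L²(μ_δ)` — two-sided control of the NESS log-density to first order,
"not in print": hypoelliptic regularity + Gaussian-type tails, cf. Rey-Bellet–Thomas 2002 upper tails). Uniqueness of
`h` a.e. (weak derivatives are unique in `L²`) makes "every `h`" and "some `h`" equivalent. -/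
theorem stub_snapshotKLUpper :
    ∀ ω₂ lam β γ : ℝ, 0 < ω₂ → 0 < lam → 0 < β → 0 < γ →
      (∀ (N : ℕ) (T_L T_R : ℝ), 0 < T_L → 0 < T_R → ∀ μ ν : Measure (PhaseSpace N),
        (pinnedChain ω₂ lam β γ).IsSteadyState N T_L T_R μ →
        (pinnedChain ω₂ lam β γ).IsSteadyState N T_L T_R ν → μ = ν) →
      ∀ μ : (N : ℕ) → ℝ → ℝ → Measure (PhaseSpace N),
        (∀ (N : ℕ) (T_L T_R : ℝ), 0 < T_L → 0 < T_R →
          (pinnedChain ω₂ lam β γ).IsSteadyState N T_L T_R (μ N T_L T_R)) →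
        ∀ T : ℝ, 0 < T → ∀ N : ℕ, 2 ≤ N → ∀ h : PhaseSpace N → ℝ,
          (MemLp h 2 (μ N T T) ∧
            (∀ F : PhaseSpace N → ℝ, ContDiff ℝ ((⊤ : ℕ∞) : WithTop ℕ∞) F → HasCompactSupport F →
              Tendsto (fun δ : ℝ => ((∫ x, F x ∂(μ N (T + δ / 2) (T - δ / 2))) - ∫ x, F x ∂(μ N T T)) / δ)
                (𝓝[≠] (0 : ℝ)) (𝓝 (∫ x, F x * h x ∂(μ N T T)))) ∧
            (∀ i : Fin N, Tendsto (fun δ : ℝ =>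
                ((∫ x, (pinnedChain ω₂ lam β γ).bondCurrent N i x ∂(μ N (T + δ / 2) (T - δ / 2))) -
                  ∫ x, (pinnedChain ω₂ lam β γ).bondCurrent N i x ∂(μ N T T)) / δ)
                (𝓝[≠] (0 : ℝ)) (𝓝 (∫ x, (pinnedChain ω₂ lam β γ).bondCurrent N i x * h x ∂(μ N T T))))) →
          ∀ K : ℝ, (1 / 2 : ℝ) * ∫ x, (h x - h (x.1, -x.2)) ^ 2 ∂(μ N T T) < K →
            ∀ᶠ δ in 𝓝[≠] (0 : ℝ),
              klDiv (μ N (T + δ / 2) (T - δ / 2))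
                  (Measure.map (fun x : PhaseSpace N => (x.1, -x.2)) (μ N (T + δ / 2) (T - δ / 2)))
                ≤ ENNReal.ofReal (K * δ ^ 2) :=
  -- CLOSED modulo S1d by the LANDED reduction (p91778): Theorems/…SnapshotKLUpperReduction.lean
  Summit.AtomisticToContinuum.FouriersLaw.Theorems.ExtensiveSnapshotIrreversibility.ClausiusBudget.stub_snapshotKLUpper_of_density
    stub_oddLogDensity

/-- **S2a `stub_correctorIntegrability`** (fixed `N ≥ 2`, size M/L, provable now). Given (INV) and (MIX): the McLennan
integral converges absolutely for every starting point, `w`, `k τ`, `P_τ w ∈ L²(μ_T)`, and the WINDOW IDENTITY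
`w = k τ + P_τ w` holds POINTWISE for every `τ ≥ 0`. Why true: `|g| ≤ (γ/T²)(1/ϑ)e^{ϑH}` (`H ≥ 0`,
`pinnedChain_hamiltonian_nonneg`) and `μ_T(g) = 0` (the two contact momenta are identically distributed under `μ_T`:
reflection symmetry of the Gibbs density / `p_i ~ N(0,T)` given `q`), so (MIX) with `ϑ = 1/(4T)` gives
`|Pg s z| ≤ C' e^{ϑH(z)} e^{−cs}`: integrable in `s`; `|w z| ≤ (C'/c) e^{ϑH(z)}` with `e^{2ϑH} ∈ L¹(μ_T)`
(`pinnedChain_integrable_exp_mul_hamiltonian_gibbsMeasure`, `2ϑ < 1/T`); `∫_{s>τ} Pg s z ds = ∫_{u>0} Pg (τ+u) z du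
= ∫ (∫_{u>0} Pg u x du) d(κ_τ z)(x) = P_τ w (z)` by Chapman–Kolmogorov (`pinnedChain_transitionKernel_add`) and Fubini
(integrable majorant `(C'/c) e^{ϑH(x)}`, `∫ e^{ϑH} dκ_τ(z) ≤ e^{2ϑγTτ} e^{ϑH(z)}`:
`lintegral_exp_mul_hamiltonian_pinnedChainSemigroup_le`); measurability from `pinnedChain_measurable_transitionKernel` /
`stronglyMeasurable_uncurry_act`. -/
theorem stub_correctorIntegrability :
    ∀ ω₂ lam β γ : ℝ, 0 < ω₂ → 0 < lam → 0 < β → 0 < γ → ∀ T : ℝ, 0 < T → ∀ (N : ℕ) (hN : 2 ≤ N),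
      let P := pinnedChain ω₂ lam β γ
      let μT := P.gibbsMeasure N T
      (∀ t : ℝ≥0, μT.bind (P.transitionKernel N T T t) = μT) →
      (∀ ϑ : ℝ, 0 < ϑ → ϑ < 1 / T → ∃ C c : ℝ, 0 < C ∧ 0 < c ∧
        ∀ (z : PhaseSpace N) (t : ℝ≥0) (f : PhaseSpace N → ℝ), Continuous f →
          (∀ y, |f y| ≤ Real.exp (ϑ * P.hamiltonian N y)) →
          |(∫ y, f y ∂(P.transitionKernel N T T t z)) - ∫ y, f y ∂μT| ≤
            C * Real.exp (ϑ * P.hamiltonian N z) * Real.exp (-c * t)) →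
      let g : PhaseSpace N → ℝ := fun y =>
        γ / (2 * T ^ 2) * (y.2 ⟨0, by omega⟩ ^ 2 - y.2 ⟨N - 1, by omega⟩ ^ 2)
      let Pg : ℝ → PhaseSpace N → ℝ := fun s z => ∫ y, g y ∂(P.transitionKernel N T T s.toNNReal z)
      let k : ℝ → PhaseSpace N → ℝ := fun τ z => ∫ s in (0 : ℝ)..τ, Pg s z
      let w : PhaseSpace N → ℝ := fun z => ∫ s in Set.Ioi (0 : ℝ), Pg s z
      let Pw : ℝ → PhaseSpace N → ℝ := fun τ z => ∫ x, w x ∂(P.transitionKernel N T T τ.toNNReal z)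
      (∀ z : PhaseSpace N, IntegrableOn (fun s => Pg s z) (Set.Ioi (0 : ℝ))) ∧
      MemLp w 2 μT ∧
      ∀ τ : ℝ, 0 ≤ τ → MemLp (k τ) 2 μT ∧ MemLp (Pw τ) 2 μT ∧ ∀ z : PhaseSpace N, w z = k τ z + Pw τ z :=
  -- LANDED (p81088): Theorems/BondHeatUncertaintyExtensiveSnapshotIrreversibilityCorrectorIntegrability.lean
  Summit.AtomisticToContinuum.FouriersLaw.Theorems.ExtensiveSnapshotIrreversibility.ClausiusBudget.stub_correctorIntegrability

/-- **S2b `stub_correctorCocycle`** (fixed `N`, size M, provable now; pure `L²(μ_T)` bookkeeping). For `T > 0`, `τ`, and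
functions `w, kτ, Pwτ ∈ L²(μ_T)` with `w = kτ + Pwτ` pointwise:
`√∫(w − w∘Θ)² dμ_T ≤ 2√∫kτ² dμ_T + √∫(Pwτ − Pwτ∘Θ)² dμ_T` — Minkowski in `L²(μ_T)` and `‖kτ∘Θ‖ = ‖kτ‖` by the
flip-invariance of the Gibbs measure (`gibbsMeasure_map_flip`, landed in Negative/DegenerateInstances; `integral_map`).
Stated for ARBITRARY functions (the line instantiates `w, k τ, Pw τ` of S2a), so no kernel enters. -/
theorem stub_correctorCocycle :
    ∀ ω₂ lam β γ : ℝ, 0 < ω₂ → 0 < lam → 0 < β → 0 < γ → ∀ T : ℝ, 0 < T → ∀ (N : ℕ),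
      ∀ w kτ Pwτ : PhaseSpace N → ℝ,
        MemLp w 2 ((pinnedChain ω₂ lam β γ).gibbsMeasure N T) →
        MemLp kτ 2 ((pinnedChain ω₂ lam β γ).gibbsMeasure N T) →
        MemLp Pwτ 2 ((pinnedChain ω₂ lam β γ).gibbsMeasure N T) →
        (∀ z : PhaseSpace N, w z = kτ z + Pwτ z) →
        Real.sqrt (∫ z, (w z - w (z.1, -z.2)) ^ 2 ∂((pinnedChain ω₂ lam β γ).gibbsMeasure N T)) ≤
          2 * Real.sqrt (∫ z, (kτ z) ^ 2 ∂((pinnedChain ω₂ lam β γ).gibbsMeasure N T)) +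
            Real.sqrt (∫ z, (Pwτ z - Pwτ (z.1, -z.2)) ^ 2 ∂((pinnedChain ω₂ lam β γ).gibbsMeasure N T)) :=
  -- LANDED (p82521): Theorems/BondHeatUncertaintyExtensiveSnapshotIrreversibilityCorrectorCocycle.lean
  Summit.AtomisticToContinuum.FouriersLaw.Theorems.ExtensiveSnapshotIrreversibility.ClausiusBudget.stub_correctorCocycle

/-- **S3a `stub_gibbsContactCalculus`** (STATIC, every `N ≥ 1`, size M, provable now from `integral_liouville_mul_gibbsDensity`
/ `integral_bath_mul_gibbsDensity` / `integral_mul_eq_neg_of_hasLineDerivAt`). For `T > 0` and every `f ∈ C_c^∞`: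
(a) the `L²(μ_T)` DIRICHLET FORM of the equilibrium generator is the Ornstein–Uhlenbeck form of the two contact momenta,
`∫ f · (L_{T,T} f) dμ_T = −γT Σ_i (1[i=0] + 1[i=N−1]) ∫ (∂_{p_i} f)² dμ_T` (the Liouville part is antisymmetric: apply
`∫ L(f²) dμ_T = 0` — Gibbs is steady — and the product rule `L(f²) = 2fLf + 2γ Σ_b T (∂_{p_b}f)²`); (b) GAUSSIAN
INTEGRATION BY PARTS in a contact momentum: `∫ (p_i² − T) f dμ_T = T ∫ p_i ∂_{p_i} f dμ_T` for every site `i`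
(`∂_{p_i} e^{−H/T} = −(p_i/T) e^{−H/T}`). Both are bulk-independent identities; (a)+(b)+Cauchy–Schwarz are the pointwise-in-time
content of the Clausius budget. -/
theorem stub_gibbsContactCalculus :
    ∀ ω₂ lam β γ : ℝ, 0 < ω₂ → 0 < lam → 0 < β → 0 < γ → ∀ T : ℝ, 0 < T → ∀ N : ℕ, 0 < N →
      ∀ f : PhaseSpace N → ℝ, ContDiff ℝ (⊤ : ℕ∞) f → HasCompactSupport f →
        (∫ x, f x * (pinnedChain ω₂ lam β γ).generator N T T f x ∂((pinnedChain ω₂ lam β γ).gibbsMeasure N T) =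
          -(γ * T) * ∑ i : Fin N, ((if i.val = 0 then (1 : ℝ) else 0) + (if i.val = N - 1 then (1 : ℝ) else 0)) *
            ∫ x, (partialP i f x) ^ 2 ∂((pinnedChain ω₂ lam β γ).gibbsMeasure N T)) ∧
        (∀ i : Fin N, ∫ x, (x.2 i ^ 2 - T) * f x ∂((pinnedChain ω₂ lam β γ).gibbsMeasure N T) =
          T * ∫ x, x.2 i * partialP i f x ∂((pinnedChain ω₂ lam β γ).gibbsMeasure N T)) :=
  -- LANDED (p82446): Theorems/BondHeatUncertaintyExtensiveSnapshotIrreversibilityGibbsContactCalculus.lean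
  Summit.AtomisticToContinuum.FouriersLaw.Theorems.ExtensiveSnapshotIrreversibility.ClausiusBudget.stub_gibbsContactCalculus

/-- **S3b `stub_clausiusBudget`** (THE LEVER; every `N ≥ 2`, constant free of `N` and of the bulk potentials; size L/XL as a
formalisation). Under the guard, for `T > 0`, given (INV), (MIX), the static contact calculus (a)/(b) of S3a on `C_c^∞`, and
`k τ ∈ L²(μ_T)` for all `τ ≥ 0`: `‖k τ‖²_{L²(μ_T)} ≤ γτ/(4T²)` for every `τ ≥ 0`.
Why true ("the arrow of time can only be pumped at the Clausius rate"): `k_t` solves `d/dt k_t = L_T k_t + g`, `k_0 = 0`;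
by (a) `d/dt ½‖k_t‖² = −γT Σ_{i∈∂}‖∂_{p_i}k_t‖² + ⟨g, k_t⟩`, by (b) and Cauchy–Schwarz (`‖p_i‖_{L²(μ_T)} = √T`)
`|⟨g, k_t⟩| ≤ (γ/2√T)(‖∂_{p_0}k_t‖ + ‖∂_{p_{N−1}}k_t‖)`, hence `d/dt ½‖k_t‖² ≤ 2·max_x(−γTx² + γx/(2√T)) = γ/(8T²)`.
Debt (the formalisation content): extending (a)/(b) from `C_c^∞` to the orbit `k_t` (regularity/growth of `P_s g`, energy
identity for the hypoelliptic semigroup on a core, or a mollified/Steklov version of the argument); harmonic check: max ratio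
`0.770–0.814 < 1` (pure OU transient `(1−e^{−2x})²/x ≤ 0.8145`). -/
theorem stub_clausiusBudget :
    ∀ ω₂ lam β γ : ℝ, 0 < ω₂ → 0 < lam → 0 < β → 0 < γ →
      (∀ (N : ℕ) (T_L T_R : ℝ), 0 < T_L → 0 < T_R → ∀ μ ν : Measure (PhaseSpace N),
        (pinnedChain ω₂ lam β γ).IsSteadyState N T_L T_R μ →
        (pinnedChain ω₂ lam β γ).IsSteadyState N T_L T_R ν → μ = ν) →
      ∀ T : ℝ, 0 < T → ∀ (N : ℕ) (hN : 2 ≤ N),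
        let P := pinnedChain ω₂ lam β γ
        let μT := P.gibbsMeasure N T
        (∀ t : ℝ≥0, μT.bind (P.transitionKernel N T T t) = μT) →
        (∀ ϑ : ℝ, 0 < ϑ → ϑ < 1 / T → ∃ C c : ℝ, 0 < C ∧ 0 < c ∧
          ∀ (z : PhaseSpace N) (t : ℝ≥0) (f : PhaseSpace N → ℝ), Continuous f →
            (∀ y, |f y| ≤ Real.exp (ϑ * P.hamiltonian N y)) →
            |(∫ y, f y ∂(P.transitionKernel N T T t z)) - ∫ y, f y ∂μT| ≤
              C * Real.exp (ϑ * P.hamiltonian N z) * Real.exp (-c * t)) →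
        (∀ f : PhaseSpace N → ℝ, ContDiff ℝ (⊤ : ℕ∞) f → HasCompactSupport f →
          (∫ x, f x * P.generator N T T f x ∂μT =
            -(γ * T) * ∑ i : Fin N, ((if i.val = 0 then (1 : ℝ) else 0) + (if i.val = N - 1 then (1 : ℝ) else 0)) *
              ∫ x, (partialP i f x) ^ 2 ∂μT) ∧
          (∀ i : Fin N, ∫ x, (x.2 i ^ 2 - T) * f x ∂μT = T * ∫ x, x.2 i * partialP i f x ∂μT)) →
        let g : PhaseSpace N → ℝ := fun y =>
          γ / (2 * T ^ 2) * (y.2 ⟨0, by omega⟩ ^ 2 - y.2 ⟨N - 1, by omega⟩ ^ 2)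
        let Pg : ℝ → PhaseSpace N → ℝ := fun s z => ∫ y, g y ∂(P.transitionKernel N T T s.toNNReal z)
        let k : ℝ → PhaseSpace N → ℝ := fun τ z => ∫ s in (0 : ℝ)..τ, Pg s z
        (∀ τ : ℝ, 0 ≤ τ → MemLp (k τ) 2 μT) →
        ∀ τ : ℝ, 0 ≤ τ → ∫ z, (k τ z) ^ 2 ∂μT ≤ γ * τ / (4 * T ^ 2) :=
  -- LANDED (p89857): Theorems/BondHeatUncertaintyExtensiveSnapshotIrreversibilityClausiusBudget.lean
  Summit.AtomisticToContinuum.FouriersLaw.Theorems.ExtensiveSnapshotIrreversibility.ClausiusBudget.stub_clausiusBudget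

/-- **S4k `stub_kuboCorrectorOddCubicBound`** (HARDEST, the lead's; `N`-UNIFORM; CRUX-SIZED — reshaped by the c4 lead 2026-08-16 from
S4o into the sibling route's currency). For `T > 0` there is `C` such that for every `N ≥ 2` and every `u ∈ L²(μ_T)` that is a
`μ_T`-a.e. limit of the finite-horizon Kubo integrals `∫₀^τ P_t J_tot dt` of the TOTAL current `J_tot = Σ_i j_i` under the
equal-temperature open kernels (the predicate of the sibling items `OddDensityIsCorrector` (9146, PROVED) / `ConeScaleCorrector`
(E1, stmt-14069, OPEN), here over the normalised Gibbs measure): `∫ (u − u∘Θ)² dμ_T ≤ C·N³`. Why this is S4o again: by 9146,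
`h − h∘Θ = (u − u∘Θ)/((N−1)T²)` a.e. for every response density `h`, and by S1a/S1b `∫(h − h∘Θ)² = ∫(w − w∘Θ)²`, so
`∫(w − w∘Θ)² dμ_T = ∫(u − u∘Θ)² dμ_T/((N−1)²T⁴)` EXACTLY (landed as `oddCorrectorBound_of_kuboCorrectorOddCubic`); the cubic
threshold is the linear one of S4o. Why this form: the sibling route `OddSectorIrreversibility` attacks `∫ u² dμ_T ≤ C·N²` (E1,
rank-2 crux, live seats) — stronger by a factor `N` and by the even sector; E1 ⟹ S4k is landed (`kuboCorrectorOddCubic_of_coneScale`),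
so (K)'s whole `N`-uniform debt is discharged the moment E1 (or any cubic/odd weakening of it) lands. Anchors: harmonic corner
`∫(u − u∘Θ)² = 2(N−1)²T⁴K_N ≈ N³/3` (cubic: E1's `N²` fails there, S4k is order-tight); anharmonic `pinnedChain 1 1 1 1`, `T = 1`:
`≈ 0.32·N³` to `N = 64` (c0/c1 MD), sibling numerics `a_N = N∫(h−hΘ)²` linear to `N = 128` at `T = 1` and at a diffusive point
(kit j012450) — consistent with cubic, no slack in the exponent at accessible `N`. No technique in print gives any polynomial bound
(see `Cruxes/…/NOTES.md` and the c4 analysis memo: the resolvent form needs the `L²(μ_T)` relaxation time `τ_N ≤ C·N`, false-shaped;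
Brascamp–Lieb reduces the static `L²` form to an extensive Dirichlet energy, true-shaped but a first-variation estimate). -/
theorem stub_kuboCorrectorOddCubicBound :
    ∀ ω₂ lam β γ : ℝ, 0 < ω₂ → 0 < lam → 0 < β → 0 < γ → ∀ T : ℝ, 0 < T → ∃ C : ℝ,
      ∀ (N : ℕ) (u : PhaseSpace N → ℝ), 2 ≤ N →
        let P := pinnedChain ω₂ lam β γ
        let μT := P.gibbsMeasure N T
        let J : PhaseSpace N → ℝ := fun z => ∑ i : Fin N, P.bondCurrent N i z
        MemLp u 2 μT →
        (∀ᵐ x ∂μT, Tendsto (fun τ : ℝ => ∫ t in Set.Ioc (0 : ℝ) τ,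
            (∫ y, J y ∂(P.transitionKernel N T T t.toNNReal x))) atTop (𝓝 (u x))) →
        ∫ x, (u x - u (x.1, -x.2)) ^ 2 ∂μT ≤ C * (N : ℝ) ^ 3 := by
  sorry

/-- **S4o `stub_oddCorrectorBound`** — DERIVED (v10, c4 lead 2026-08-16): S4o := `oddCorrectorBound_of_kuboCorrectorOddCubic` (landed)
applied to S4k. Statement unchanged since v9 (c3): under the guard, for `T > 0` there is `C` such that for every `N ≥ 2` the McLennan
corrector `w = ∫₀^∞ P_s g ds` (`g = (γ/2T²)(p_0² − p_{N−1}²)`) has `∫ (w − w∘Θ)² dμ_T ≤ C·N` — by S1a–S1d exactly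
`limsup_δ δ⁻² KL ≤ (C/2)·N`, the crux's whole `N`-uniform content. -/
theorem stub_oddCorrectorBound :
    ∀ ω₂ lam β γ : ℝ, 0 < ω₂ → 0 < lam → 0 < β → 0 < γ →
      (∀ (N : ℕ) (T_L T_R : ℝ), 0 < T_L → 0 < T_R → ∀ μ ν : Measure (PhaseSpace N),
        (pinnedChain ω₂ lam β γ).IsSteadyState N T_L T_R μ →
        (pinnedChain ω₂ lam β γ).IsSteadyState N T_L T_R ν → μ = ν) →
      ∀ T : ℝ, 0 < T → ∃ C : ℝ, ∀ (N : ℕ) (hN : 2 ≤ N),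
        let P := pinnedChain ω₂ lam β γ
        let μT := P.gibbsMeasure N T
        let g : PhaseSpace N → ℝ := fun y =>
          γ / (2 * T ^ 2) * (y.2 ⟨0, by omega⟩ ^ 2 - y.2 ⟨N - 1, by omega⟩ ^ 2)
        let Pg : ℝ → PhaseSpace N → ℝ := fun s z => ∫ y, g y ∂(P.transitionKernel N T T s.toNNReal z)
        let w : PhaseSpace N → ℝ := fun z => ∫ s in Set.Ioi (0 : ℝ), Pg s z
        ∫ z, (w z - w (z.1, -z.2)) ^ 2 ∂μT ≤ C * N :=
  Summit.AtomisticToContinuum.FouriersLaw.Theorems.ExtensiveSnapshotIrreversibility.ClausiusBudget.oddCorrectorBound_of_kuboCorrectorOddCubic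
    stub_kuboCorrectorOddCubicBound

/-- **S4 `stub_lateOddResponse`** — DERIVED (v9, c3 lead 2026-08-16): S4 ⟸ S4o at `τ = 0`, `c = 1` (`P_0 = id` by
`pinnedChain_transitionKernel_zero`, `w ∈ L²(μ_T)` from the landed S2a; the same argument is landed stand-alone as
`lateOddResponse_of_oddCorrectorBound`). Statement unchanged since v3: under the guard, for `T > 0` there are `C` and `c > 0`
such that for every `N ≥ 2`, given (INV) and (MIX), SOME `τ ∈ [0, cN]` has `P_τ w ∈ L²(μ_T)` and `D(P_τ w) ≤ C·N`. -/
theorem stub_lateOddResponse :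
    ∀ ω₂ lam β γ : ℝ, 0 < ω₂ → 0 < lam → 0 < β → 0 < γ →
      (∀ (N : ℕ) (T_L T_R : ℝ), 0 < T_L → 0 < T_R → ∀ μ ν : Measure (PhaseSpace N),
        (pinnedChain ω₂ lam β γ).IsSteadyState N T_L T_R μ →
        (pinnedChain ω₂ lam β γ).IsSteadyState N T_L T_R ν → μ = ν) →
      ∀ T : ℝ, 0 < T → ∃ C c : ℝ, 0 < c ∧ ∀ (N : ℕ) (hN : 2 ≤ N),
        let P := pinnedChain ω₂ lam β γ
        let μT := P.gibbsMeasure N T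
        (∀ t : ℝ≥0, μT.bind (P.transitionKernel N T T t) = μT) →
        (∀ ϑ : ℝ, 0 < ϑ → ϑ < 1 / T → ∃ C c : ℝ, 0 < C ∧ 0 < c ∧
          ∀ (z : PhaseSpace N) (t : ℝ≥0) (f : PhaseSpace N → ℝ), Continuous f →
            (∀ y, |f y| ≤ Real.exp (ϑ * P.hamiltonian N y)) →
            |(∫ y, f y ∂(P.transitionKernel N T T t z)) - ∫ y, f y ∂μT| ≤
              C * Real.exp (ϑ * P.hamiltonian N z) * Real.exp (-c * t)) →
        let g : PhaseSpace N → ℝ := fun y =>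
          γ / (2 * T ^ 2) * (y.2 ⟨0, by omega⟩ ^ 2 - y.2 ⟨N - 1, by omega⟩ ^ 2)
        let Pg : ℝ → PhaseSpace N → ℝ := fun s z => ∫ y, g y ∂(P.transitionKernel N T T s.toNNReal z)
        let w : PhaseSpace N → ℝ := fun z => ∫ s in Set.Ioi (0 : ℝ), Pg s z
        let Pw : ℝ → PhaseSpace N → ℝ := fun τ z => ∫ x, w x ∂(P.transitionKernel N T T τ.toNNReal z)
        ∃ τ : ℝ, 0 ≤ τ ∧ τ ≤ c * N ∧ MemLp (Pw τ) 2 μT ∧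
          ∫ z, (Pw τ z - Pw τ (z.1, -z.2)) ^ 2 ∂μT ≤ C * N := by
  intro ω₂ lam β γ hω hl hβ hγ hU T hT
  obtain ⟨C', hC'⟩ := stub_oddCorrectorBound ω₂ lam β γ hω hl hβ hγ hU T hT
  refine ⟨max C' 0, 1, one_pos, fun N hN => ?_⟩
  intro P μT hInv hMix g Pg w Pw
  -- `w ∈ L²(μ_T)` from the landed S2a
  obtain ⟨-, hw2, -⟩ := stub_correctorIntegrability ω₂ lam β γ hω hl hβ hγ T hT N hN hInv hMix
  have hON : ∫ z, (w z - w (z.1, -z.2)) ^ 2 ∂μT ≤ C' * N := hC' N hN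
  -- `P_0 w = w`
  have hP0 : ∀ z, Pw 0 z = w z := by
    intro z
    show ∫ x, w x ∂(P.transitionKernel N T T (Real.toNNReal 0) z) = w z
    rw [Real.toNNReal_zero, pinnedChain_transitionKernel_zero hω hl.le hβ.le hγ.le N T T,
      ProbabilityTheory.Kernel.id_apply, integral_dirac]
  have hPw0 : Pw 0 = w := funext hP0
  have hN0 : (0 : ℝ) ≤ N := by positivity
  refine ⟨0, le_rfl, by positivity, ?_, ?_⟩
  · rw [hPw0]; exact hw2
  · rw [hPw0]
    calc ∫ z, (w z - w (z.1, -z.2)) ^ 2 ∂μT ≤ C' * N := hON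
      _ ≤ max C' 0 * N := mul_le_mul_of_nonneg_right (le_max_left C' 0) hN0



/-! ## Glue (sorry-free) -/

/-- Real arithmetic of the window split: `√D ≤ 2√A' + √B'`, `A' ≤ A`, `B' ≤ B` (all nonnegative) give
`D ≤ 8A + 2B`. -/
theorem sq_bound_of_sqrt_le {D A' B' A B : ℝ} (hD : 0 ≤ D) (hA' : 0 ≤ A') (hB' : 0 ≤ B')
    (hA : A' ≤ A) (hB : B' ≤ B) (h : Real.sqrt D ≤ 2 * Real.sqrt A' + Real.sqrt B') :
    D ≤ 8 * A + 2 * B := by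
  have hsA : Real.sqrt A' ≤ Real.sqrt A := Real.sqrt_le_sqrt hA
  have hsB : Real.sqrt B' ≤ Real.sqrt B := Real.sqrt_le_sqrt hB
  have hA0 : 0 ≤ A := hA'.trans hA
  have hB0 : 0 ≤ B := hB'.trans hB
  have h' : Real.sqrt D ≤ 2 * Real.sqrt A + Real.sqrt B := h.trans (by linarith)
  have h1 : Real.sqrt D * Real.sqrt D ≤ (2 * Real.sqrt A + Real.sqrt B) * (2 * Real.sqrt A + Real.sqrt B) :=
    mul_self_le_mul_self (Real.sqrt_nonneg _) h'
  have hDD : Real.sqrt D * Real.sqrt D = D := Real.mul_self_sqrt hD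
  have hAA : Real.sqrt A * Real.sqrt A = A := Real.mul_self_sqrt hA0
  have hBB : Real.sqrt B * Real.sqrt B = B := Real.mul_self_sqrt hB0
  nlinarith [sq_nonneg (2 * Real.sqrt A - Real.sqrt B), Real.sqrt_nonneg A, Real.sqrt_nonneg B]

/-- **Abstract arithmetic core of the composition.** For one parameter point, one family and one `T > 0`: with
`Dw N` the reversal asymmetry of the corrector, `Wk N τ` the squared window norm and `Dl N τ` the late reversal
asymmetry (any real-valued bookkeeping functions, nonnegative), the four stub-shaped hypotheses give the crux's conclusion
with `C_K = γc/T² + max C 0 + 1`; `N = 0, 1` by the landed Negative lemmas. -/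
theorem concl_of_parts {ω₂ lam β γ : ℝ} (hω : 0 < ω₂) (hl : 0 < lam) (hβ : 0 < β) (hγ : 0 < γ)
    (hU : ∀ (N : ℕ) (T_L T_R : ℝ), 0 < T_L → 0 < T_R → ∀ μ ν : Measure (PhaseSpace N),
      (pinnedChain ω₂ lam β γ).IsSteadyState N T_L T_R μ →
      (pinnedChain ω₂ lam β γ).IsSteadyState N T_L T_R ν → μ = ν)
    {μ : (N : ℕ) → ℝ → ℝ → Measure (PhaseSpace N)}
    (hμ : ∀ (N : ℕ) (T_L T_R : ℝ), 0 < T_L → 0 < T_R →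
      (pinnedChain ω₂ lam β γ).IsSteadyState N T_L T_R (μ N T_L T_R))
    {T : ℝ} (hT : 0 < T) {C c : ℝ} (hc : 0 < c)
    (Dw : ℕ → ℝ) (Wk Dl : ℕ → ℝ → ℝ) (hDw : ∀ N, 0 ≤ Dw N) (hWk : ∀ N τ, 0 ≤ Wk N τ) (hDl : ∀ N τ, 0 ≤ Dl N τ)
    (hKL : ∀ N : ℕ, 2 ≤ N → ∀ ε : ℝ, 0 < ε → ∀ᶠ δ in 𝓝[≠] (0 : ℝ),
      klDiv (μ N (T + δ / 2) (T - δ / 2))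
          (Measure.map (fun x : PhaseSpace N => (x.1, -x.2)) (μ N (T + δ / 2) (T - δ / 2)))
        ≤ ENNReal.ofReal ((Dw N / 2 + ε) * δ ^ 2))
    (hSplit : ∀ N : ℕ, 2 ≤ N → ∀ τ : ℝ, 0 ≤ τ →
      Real.sqrt (Dw N) ≤ 2 * Real.sqrt (Wk N τ) + Real.sqrt (Dl N τ))
    (hBudget : ∀ N : ℕ, 2 ≤ N → ∀ τ : ℝ, 0 ≤ τ → Wk N τ ≤ γ * τ / (4 * T ^ 2))
    (hLate : ∀ N : ℕ, 2 ≤ N → ∃ τ : ℝ, 0 ≤ τ ∧ τ ≤ c * N ∧ Dl N τ ≤ C * N) :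
    ∃ C' : ℝ, ∀ N : ℕ, ∀ᶠ δ in 𝓝[≠] (0 : ℝ),
      klDiv (μ N (T + δ / 2) (T - δ / 2))
          (Measure.map (fun x : PhaseSpace N => (x.1, -x.2)) (μ N (T + δ / 2) (T - δ / 2)))
        ≤ ENNReal.ofReal (C' * (N : ℝ) * δ ^ 2) := by
  refine ⟨γ * c / T ^ 2 + max C 0 + 1, fun N => ?_⟩
  rcases Nat.lt_or_ge N 2 with hN | hN
  · interval_cases N
    · exact extensiveSnapshotIrreversibility_bound_at_zero hμ hT _
    · exact extensiveSnapshotIrreversibility_bound_at_one hω hl hβ hU hμ hT _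
  · have hN0 : (0 : ℝ) ≤ N := by positivity
    have hN1 : (1 : ℝ) ≤ N := by exact_mod_cast (le_trans (by norm_num) hN)
    obtain ⟨τ, hτ0, hτc, hL⟩ := hLate N hN
    have hT2 : 0 < T ^ 2 := by positivity
    have hBτ : Wk N τ ≤ γ * (c * N) / (4 * T ^ 2) :=
      (hBudget N hN τ hτ0).trans
        (div_le_div_of_nonneg_right (mul_le_mul_of_nonneg_left hτc hγ.le) (by positivity))
    have hkey : Dw N ≤ 8 * (γ * (c * N) / (4 * T ^ 2)) + 2 * (max C 0 * N) :=
      sq_bound_of_sqrt_le (hDw N) (hWk N τ) (hDl N τ) hBτ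
        (hL.trans (mul_le_mul_of_nonneg_right (le_max_left _ _) hN0))
        (hSplit N hN τ hτ0)
    filter_upwards [hKL N hN 1 one_pos] with δ hδ
    refine hδ.trans (ENNReal.ofReal_le_ofReal ?_)
    have hδ2 : 0 ≤ δ ^ 2 := sq_nonneg δ
    apply mul_le_mul_of_nonneg_right _ hδ2
    have h8 : 8 * (γ * (c * N) / (4 * T ^ 2)) = 2 * (γ * c / T ^ 2 * N) := by
      field_simp
      ring
    rw [h8] at hkey
    have hgc : 0 ≤ γ * c / T ^ 2 := by positivity
    have hm : 0 ≤ max C 0 := le_max_right _ _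
    nlinarith [hkey, hgc, hm, hN1, mul_nonneg hgc hN0, mul_nonneg hm hN0]

/-- **The composition** — concludes the crux `ExtensiveSnapshotIrreversibility` BY NAME from the stubs (S1 split into S1a/S1b/S1c ⟸ S1d ⟸ S1r' + S1g'; S4 ⟸ S4o ⟸ S4k). -/
theorem ExtensiveSnapshotIrreversibility_of : ExtensiveSnapshotIrreversibility := by
  intro ω₂ lam β γ hω hl hβ hγ hU μ hμ T hT
  obtain ⟨C, c, hc, hLate⟩ := stub_lateOddResponse ω₂ lam β γ hω hl hβ hγ hU T hT
  -- bookkeeping functions (the line's objects at `N`, as real numbers)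
  let g : (N : ℕ) → 2 ≤ N → PhaseSpace N → ℝ := fun N hN y =>
    γ / (2 * T ^ 2) * (y.2 ⟨0, by omega⟩ ^ 2 - y.2 ⟨N - 1, by omega⟩ ^ 2)
  let Pg : (N : ℕ) → 2 ≤ N → ℝ → PhaseSpace N → ℝ := fun N hN s z =>
    ∫ y, g N hN y ∂((pinnedChain ω₂ lam β γ).transitionKernel N T T s.toNNReal z)
  let k : (N : ℕ) → 2 ≤ N → ℝ → PhaseSpace N → ℝ := fun N hN τ z => ∫ s in (0 : ℝ)..τ, Pg N hN s z
  let w : (N : ℕ) → 2 ≤ N → PhaseSpace N → ℝ := fun N hN z => ∫ s in Set.Ioi (0 : ℝ), Pg N hN s z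
  let Pw : (N : ℕ) → 2 ≤ N → ℝ → PhaseSpace N → ℝ := fun N hN τ z =>
    ∫ x, w N hN x ∂((pinnedChain ω₂ lam β γ).transitionKernel N T T τ.toNNReal z)
  let μT : (N : ℕ) → Measure (PhaseSpace N) := fun N => (pinnedChain ω₂ lam β γ).gibbsMeasure N T
  let Dw : ℕ → ℝ := fun N =>
    if hN : 2 ≤ N then ∫ z, (w N hN z - w N hN (z.1, -z.2)) ^ 2 ∂(μT N) else 0
  let Wk : ℕ → ℝ → ℝ := fun N τ => if hN : 2 ≤ N then ∫ z, (k N hN τ z) ^ 2 ∂(μT N) else 0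
  let Dl : ℕ → ℝ → ℝ := fun N τ =>
    if hN : 2 ≤ N then ∫ z, (Pw N hN τ z - Pw N hN τ (z.1, -z.2)) ^ 2 ∂(μT N) else 0
  have hDw : ∀ N, 0 ≤ Dw N := fun N => by
    simp only [Dw]; split_ifs
    · exact integral_nonneg fun _ => sq_nonneg _
    · exact le_rfl
  have hWk : ∀ N τ, 0 ≤ Wk N τ := fun N τ => by
    simp only [Wk]; split_ifs
    · exact integral_nonneg fun _ => sq_nonneg _
    · exact le_rfl
  have hDl : ∀ N τ, 0 ≤ Dl N τ := fun N τ => by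
    simp only [Dl]; split_ifs
    · exact integral_nonneg fun _ => sq_nonneg _
    · exact le_rfl
  -- per-`N` facts from the stubs
  have facts : ∀ N : ℕ, ∀ hN : 2 ≤ N,
      (∀ ε : ℝ, 0 < ε → ∀ᶠ δ in 𝓝[≠] (0 : ℝ),
        klDiv (μ N (T + δ / 2) (T - δ / 2))
            (Measure.map (fun x : PhaseSpace N => (x.1, -x.2)) (μ N (T + δ / 2) (T - δ / 2)))
          ≤ ENNReal.ofReal ((Dw N / 2 + ε) * δ ^ 2)) ∧
      (∀ τ : ℝ, 0 ≤ τ → Real.sqrt (Dw N) ≤ 2 * Real.sqrt (Wk N τ) + Real.sqrt (Dl N τ)) ∧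
      (∀ τ : ℝ, 0 ≤ τ → Wk N τ ≤ γ * τ / (4 * T ^ 2)) ∧
      (∃ τ : ℝ, 0 ≤ τ ∧ τ ≤ c * N ∧ Dl N τ ≤ C * N) := by
    intro N hN
    have hN0 : 0 < N := by omega
    obtain ⟨hInv, hMix⟩ := stub_equilibriumKernelFacts ω₂ lam β γ hω hl hβ hγ hU T hT N hN0
    obtain ⟨-, hw2, hwin⟩ := stub_correctorIntegrability ω₂ lam β γ hω hl hβ hγ T hT N hN hInv hMix
    have hCalc := stub_gibbsContactCalculus ω₂ lam β γ hω hl hβ hγ T hT N hN0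
    have hId := stub_mcLennanIdentification ω₂ lam β γ hω hl hβ hγ hU μ hμ T hT N hN hInv hMix hw2
    obtain ⟨h, hRD⟩ := stub_responseDensity ω₂ lam β γ hω hl hβ hγ hU μ hμ T hT N
    have hKLh := stub_snapshotKLUpper ω₂ lam β γ hω hl hβ hγ hU μ hμ T hT N hN h hRD
    have hKL : ∀ ε : ℝ, 0 < ε → ∀ᶠ δ in 𝓝[≠] (0 : ℝ),
        klDiv (μ N (T + δ / 2) (T - δ / 2))
            (Measure.map (fun x : PhaseSpace N => (x.1, -x.2)) (μ N (T + δ / 2) (T - δ / 2)))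
          ≤ ENNReal.ofReal (((∫ z, (w N hN z - w N hN (z.1, -z.2)) ^ 2 ∂(μT N)) / 2 + ε) * δ ^ 2) := by
      intro ε hε
      have hEq : ∫ x, (h x - h (x.1, -x.2)) ^ 2 ∂(μ N T T) =
          ∫ z, (w N hN z - w N hN (z.1, -z.2)) ^ 2 ∂(μT N) := hId h hRD
      refine hKLh _ ?_
      rw [hEq]
      linarith
    have hBud := stub_clausiusBudget ω₂ lam β γ hω hl hβ hγ hU T hT N hN hInv hMix hCalc
      (fun τ hτ => (hwin τ hτ).1)
    obtain ⟨τ₀, hτ₀, hτ₀c, hPw2, hL⟩ := hLate N hN hInv hMix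
    refine ⟨?_, ?_, ?_, ?_⟩
    · intro ε hε
      simpa only [Dw, dif_pos hN] using hKL ε hε
    · intro τ hτ
      obtain ⟨hk2, hPw2', hident⟩ := hwin τ hτ
      have h := stub_correctorCocycle ω₂ lam β γ hω hl hβ hγ T hT N (w N hN) (k N hN τ) (Pw N hN τ)
        hw2 hk2 hPw2' hident
      simpa only [Dw, Wk, Dl, dif_pos hN] using h
    · intro τ hτ
      simpa only [Wk, dif_pos hN] using hBud τ hτ
    · exact ⟨τ₀, hτ₀, hτ₀c, by simpa only [Dl, dif_pos hN] using hL⟩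
  exact concl_of_parts hω hl hβ hγ hU hμ hT hc Dw Wk Dl hDw hWk hDl
    (fun N hN => (facts N hN).1) (fun N hN => (facts N hN).2.1) (fun N hN => (facts N hN).2.2.1)
    (fun N hN => (facts N hN).2.2.2)

end Summit.AtomisticToContinuum.FouriersLaw.Cruxes.ExtensiveSnapshotIrreversibility.ClausiusBudgetSoundWindow

end
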